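import Literature.Computability.AlgebraicComplexity.DDS21BorderDepthThree
import HarnessLib

/-!
# DDS 2021/22, `\overline{ΠΣ} = ΠΣ` (the `k = 1` case of de-bordering `Σ^{[k]}ΠΣ`) over EVERY
# field — characteristic-free companion of the named fact `DDS2021_lemma_2_21_piSigma`

Dutta–Dwivedi–Saxena [DuttaDwivediSaxena2022], §1.1 Remark 1 and §3 (proof of Thm. 3.2, `k = 1`):
"it is easy to show that `\overline{ΠΣ} = ΠΣ` [24, Prop. A.12]". Typed (val-lit x2,
`DDS21BorderDepthThree.lean`) as `DDS2021_lemma_2_21_piSigma`: a polynomial `f ∈ F[x]` approximated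
(`MS2021.IsEpsApprox f g`: `g ∈ F[ε][x]`, `g ≡ f mod ε`) by ONE product `g = ∏_{j<d} L_j` of affine
forms over `F(ε)` is itself a product of `d` affine forms over `F`.

**Proof (every field; the paper's standing `char 0` hypothesis is not needed).** Clear denominators:
`D_j L_j` has coefficients in `F[ε]` for `D_j` the product of the denominators of the coefficients
of `L_j`, and `∏_j (D_j L_j) = D · g` with `D = ∏_j D_j ≠ 0` — an identity in `F[ε][x_1..x_n]`
(`MvPolynomial.map_injective` along `F[ε] ↪ F(ε)`). Push it along the ring map
`Φ : F[ε][x] → (F[x])[ε]` (`MvPolynomial.eval₂Hom`); over the DOMAIN `F[x]` the trailing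
coefficient (in `ε`) is multiplicative (`Polynomial.trailingCoeff_mul`), so
`∏_j tc(Φ(D_j L_j)) = tc(D) · tc(Φ g)`. Every `ε`-coefficient of `Φ(D_j L_j)` is an affine form over
`F`, `tc(D) ∈ F^×`, and `tc(Φ g) = (Φ g)(ε = 0) = f` when `f ≠ 0`; so `f = tc(D)⁻¹ ∏_j ℓ_j` is a
product of `d` affine forms. Corners: `d = 0` forces `g = 1 = f`; `f = 0` (with `d ≥ 1`) is the
product with a zero form.

Main declarations: `DDS2021.isSPS_one_of_isEpsApprox` (the statement on the tree's predicates
`MS2021.IsSPS 1 d` / `MS2021.IsEpsApprox`, any field) and `DDS2021_lemma_2_21_piSigma_allFields`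
(the `border`/`spsClass` form, any field). The fact AS TYPED (`[CharZero F]`) was discharged first by
val-lit x2 (`DDS2021_lemma_2_21_piSigma_holds`, `DDS21PiSigmaClosedProofs.lean`, ε-adic normalisation
and a trichotomy); this file is the characteristic-free companion by a different route.
-/

noncomputable section

open MvPolynomial
open scoped BigOperators Polynomial

namespace Literature.Computability.AlgebraicComplexity

namespace DDS2021

namespace Deborder

/-! ### Trailing coefficients over a domain -/

/-- Over a domain, the trailing coefficient of a product is the product of the trailing
coefficients. [folklore] -/
private theorem trailingCoeff_prod {R : Type*} [CommSemiring R] [NoZeroDivisors R] {ι : Type*}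
    (s : Finset ι) (f : ι → R[X]) :
    (∏ i ∈ s, f i).trailingCoeff = ∏ i ∈ s, (f i).trailingCoeff := by
  classical
  induction s using Finset.induction_on with
  | empty =>
    rw [Finset.prod_empty, Finset.prod_empty]
    nontriviality R
    exact (Polynomial.trailingCoeff_eq_coeff_zero (by simp)).trans Polynomial.coeff_one_zero
  | insert a s ha ih => rw [Finset.prod_insert ha, Finset.prod_insert ha, Polynomial.trailingCoeff_mul, ih]

/-- An injective ring map preserves the trailing degree. [folklore] -/
private theorem natTrailingDegree_map_of_injective {R S : Type*} [Semiring R] [Semiring S] {φ : R →+* S}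
    (hφ : Function.Injective φ) (p : R[X]) : (p.map φ).natTrailingDegree = p.natTrailingDegree := by
  by_cases hp : p = 0
  · subst hp; simp
  have hmp : p.map φ ≠ 0 := fun h => hp ((Polynomial.map_eq_zero_iff hφ).1 h)
  refine le_antisymm ?_ ?_
  · refine Polynomial.natTrailingDegree_le_of_ne_zero ?_
    rw [Polynomial.coeff_map]
    exact fun h => (Polynomial.trailingCoeff_nonzero_iff_nonzero.2 hp)
      (hφ (by rw [Polynomial.trailingCoeff, h, map_zero]))
  · refine Polynomial.natTrailingDegree_le_of_ne_zero ?_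
    intro h
    apply Polynomial.trailingCoeff_nonzero_iff_nonzero.2 hmp
    rw [Polynomial.trailingCoeff, Polynomial.coeff_map, h, map_zero]

/-- An injective ring map commutes with the trailing coefficient. [folklore] -/
private theorem trailingCoeff_map_of_injective {R S : Type*} [Semiring R] [Semiring S] {φ : R →+* S}
    (hφ : Function.Injective φ) (p : R[X]) : (p.map φ).trailingCoeff = φ p.trailingCoeff := by
  rw [Polynomial.trailingCoeff, Polynomial.trailingCoeff, natTrailingDegree_map_of_injective hφ,
    Polynomial.coeff_map]

/-! ### Affine forms -/

/-- Scaling an affine form scales its coefficients. [folklore] -/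
private theorem C_mul_affine {K : Type*} [CommSemiring K] {n : ℕ} (c : K) (a : Option (Fin n) → K) :
    (C c * (C (a none) + ∑ k : Fin n, C (a (some k)) * X k) : MvPolynomial (Fin n) K) =
      C (c * a none) + ∑ k : Fin n, C (c * a (some k)) * X k := by
  rw [mul_add, ← C_mul, Finset.mul_sum]
  refine congrArg _ (Finset.sum_congr rfl fun k _ => ?_)
  rw [← mul_assoc, ← C_mul]

end Deborder

open Deborder

/-- **`\overline{ΠΣ} = ΠΣ` on the tree's predicates, over every field**: if `g = ∏_{j<d} L_j` is ONE
product of `d` affine forms over `F(ε)` (`MS2021.IsSPS 1 d g`) approximating `f` (`MS2021.IsEpsApprox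
f g`), then `f` is a product of `d` affine forms over `F` (`MS2021.IsSPS 1 d f`). Trailing-coefficient
(Gauss) argument in `(F[x])[ε]` after clearing denominators; see the module doc.
[cite: DuttaDwivediSaxena2022, §1.1 Remark 1 and §3 proof of Thm. 3.2 (full version p0006 L140–141, p0026 L716)] -/
theorem isSPS_one_of_isEpsApprox {F : Type*} [Field F] {n d : ℕ} {f : MvPolynomial (Fin n) F}
    {g : MvPolynomial (Fin n) (RatFunc F)} (hg : MS2021.IsSPS 1 d g) (hfg : MS2021.IsEpsApprox f g) :
    MS2021.IsSPS 1 d f := by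
  classical
  -- unpack the approximation: coefficients of `g` are polynomials `p e` with `(p e)(0) = coeff e f`
  obtain ⟨hle, hcoef⟩ := hfg
  have hcast : (Fin.castLE hle : Fin n → Fin n) = id := funext fun i => Fin.ext rfl
  simp only [hcast, rename_id_apply] at hcoef
  choose p hp1 hp2 using hcoef
  set ι : F[X] →+* RatFunc F := algebraMap F[X] (RatFunc F) with hι
  have hιinj : Function.Injective ι := RatFunc.algebraMap_injective F
  -- unpack the product of affine forms
  obtain ⟨α, hgα⟩ := hg
  simp only [Finset.univ_unique, Finset.sum_singleton] at hgα
  set a : Fin d → Option (Fin n) → RatFunc F := α default with ha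
  -- the case `d = 0`: `g = 1`, hence `f = 1`
  rcases Nat.eq_zero_or_pos d with hd0 | hd
  · subst hd0
    simp only [Finset.univ_eq_empty, Finset.prod_empty] at hgα
    have hf1 : f = 1 := by
      ext e
      have h1 := hp1 e
      rw [hgα, coeff_one] at h1
      rw [← hp2 e, coeff_one]
      by_cases he : e = 0
      · subst he
        rw [if_pos rfl] at h1 ⊢
        have : p 0 = 1 := hιinj (by rw [← h1, map_one])
        rw [this, Polynomial.coeff_one_zero]
      · rw [if_neg (fun h => he h.symm)] at h1 ⊢
        have : p e = 0 := hιinj (by rw [← h1, map_zero])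
        rw [this, Polynomial.coeff_zero]
    refine ⟨fun _ _ _ => 0, ?_⟩
    simp [hf1]
  -- the case `f = 0` (`d ≥ 1`): a product with a zero form
  by_cases hf0 : f = 0
  · refine ⟨fun _ _ _ => 0, ?_⟩
    simp only [hf0, Finset.univ_unique, Finset.sum_singleton, map_zero, zero_mul, Finset.sum_const_zero,
      add_zero, Finset.prod_const, Finset.card_univ, Fintype.card_fin]
    exact (zero_pow (Nat.pos_iff_ne_zero.1 hd)).symm
  -- main case: clear denominators
  set Dj : Fin d → F[X] := fun j => ∏ o : Option (Fin n), RatFunc.denom (a j o) with hDj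
  set N : Fin d → Option (Fin n) → F[X] :=
    fun j o => RatFunc.num (a j o) * ∏ o' ∈ Finset.univ.erase o, RatFunc.denom (a j o') with hN
  have hDj0 : ∀ j, Dj j ≠ 0 := fun j =>
    Finset.prod_ne_zero_iff.2 fun o _ => RatFunc.denom_ne_zero _
  have hkey : ∀ j o, ι (N j o) = ι (Dj j) * a j o := by
    intro j o
    have hden : ι (RatFunc.denom (a j o)) ≠ 0 := fun h0 =>
      RatFunc.denom_ne_zero (a j o) (hιinj (by rw [h0, map_zero]))
    have hnum : ι (RatFunc.num (a j o)) = a j o * ι (RatFunc.denom (a j o)) :=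
      (div_eq_iff hden).1 (RatFunc.num_div_denom (a j o))
    simp only [hN, hDj, map_mul, map_prod]
    rw [← Finset.mul_prod_erase Finset.univ (fun o' => ι (RatFunc.denom (a j o'))) (Finset.mem_univ o),
      hnum]
    ring
  -- the cleared forms over `F[ε]`
  set L'' : Fin d → MvPolynomial (Fin n) F[X] :=
    fun j => C (N j none) + ∑ k : Fin n, C (N j (some k)) * X k with hL''
  have hmapL : ∀ j, MvPolynomial.map ι (L'' j) =
      C (ι (Dj j)) * (C (a j none) + ∑ k : Fin n, C (a j (some k)) * X k) := by
    intro j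
    simp only [hL'', map_add, map_sum, map_mul, map_C, map_X, hkey, C_mul_affine]
  -- the polynomial lift `g₀` of `g`
  set g₀ : MvPolynomial (Fin n) F[X] := ∑ e ∈ g.support, monomial e (p e) with hg₀
  have hcoeff_g₀ : ∀ e, coeff e g₀ = p e := by
    intro e
    rw [hg₀, coeff_sum]
    simp only [coeff_monomial]
    rw [Finset.sum_ite_eq']
    split_ifs with he
    · rfl
    · rw [MvPolynomial.notMem_support_iff] at he
      have h1 := hp1 e
      rw [he] at h1
      exact (hιinj (by rw [← h1, map_zero])).symm
  have hmapg : MvPolynomial.map ι g₀ = g := by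
    ext e
    rw [coeff_map, hcoeff_g₀, ← hp1 e]
  -- the identity `∏_j L''_j = C D * g₀` over `F[ε]`
  set D : F[X] := ∏ j, Dj j with hD
  have hD0 : D ≠ 0 := Finset.prod_ne_zero_iff.2 fun j _ => hDj0 j
  have hident : ∏ j, L'' j = C D * g₀ := by
    apply MvPolynomial.map_injective ι hιinj
    rw [map_prod, map_mul, map_C, hmapg, hgα]
    simp only [hmapL, Finset.prod_mul_distrib, ← map_prod C, ← map_prod ι, hD]
  -- push to `(F[x])[ε]`
  set Φ : MvPolynomial (Fin n) F[X] →+* (MvPolynomial (Fin n) F)[X] :=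
    eval₂Hom (Polynomial.mapRingHom (C : F →+* MvPolynomial (Fin n) F))
      (fun k => Polynomial.C (X k)) with hΦ
  have hΦC : ∀ q : F[X], Φ (C q) = q.map C := fun q => by rw [hΦ, eval₂Hom_C]; rfl
  have hΦX : ∀ k, Φ (X k) = Polynomial.C (X k) := fun k => by rw [hΦ, eval₂Hom_X']
  -- `(Φ g₀)(ε = 0) = f`
  have hconst : Polynomial.constantCoeff.comp Φ =
      (MvPolynomial.map (Polynomial.constantCoeff : F[X] →+* F) :
        MvPolynomial (Fin n) F[X] →+* MvPolynomial (Fin n) F) := by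
    refine MvPolynomial.ringHom_ext (fun q => ?_) (fun k => ?_)
    · rw [RingHom.comp_apply, hΦC, map_C, Polynomial.constantCoeff_apply, Polynomial.coeff_map]
      rfl
    · rw [RingHom.comp_apply, hΦX, map_X, Polynomial.constantCoeff_apply, Polynomial.coeff_C_zero]
  have hg₀f : (Φ g₀).coeff 0 = f := by
    have h := congrArg (fun ψ : MvPolynomial (Fin n) F[X] →+* MvPolynomial (Fin n) F => ψ g₀) hconst
    simp only [RingHom.comp_apply, Polynomial.constantCoeff_apply] at h
    rw [h]
    ext e
    rw [coeff_map, hcoeff_g₀]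
    exact hp2 e
  -- coefficients of `Φ L''_j` are affine forms over `F`
  have hcoefL : ∀ j t, (Φ (L'' j)).coeff t =
      C ((N j none).coeff t) + ∑ k : Fin n, C ((N j (some k)).coeff t) * X k := by
    intro j t
    simp only [hL'', map_add, map_sum, map_mul, hΦC, hΦX, Polynomial.coeff_add,
      Polynomial.finsetSum_coeff, Polynomial.coeff_mul_C, Polynomial.coeff_map]
  -- trailing coefficients
  have htc : C D.trailingCoeff * f =
      ∏ j, (C ((N j none).coeff (Φ (L'' j)).natTrailingDegree) +
        ∑ k : Fin n, C ((N j (some k)).coeff (Φ (L'' j)).natTrailingDegree) * X k) := by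
    have h := congrArg (fun P : MvPolynomial (Fin n) F[X] => (Φ P).trailingCoeff) hident
    simp only [map_prod, map_mul, hΦC] at h
    rw [trailingCoeff_prod, Polynomial.trailingCoeff_mul,
      trailingCoeff_map_of_injective (C_injective (Fin n) F),
      Polynomial.trailingCoeff_eq_coeff_zero (p := Φ g₀) (by rw [hg₀f]; exact hf0), hg₀f] at h
    rw [← h]
    refine Finset.prod_congr rfl fun j _ => ?_
    rw [Polynomial.trailingCoeff, hcoefL]
  -- assemble the representation of `f`
  have htcD : D.trailingCoeff ≠ 0 := Polynomial.trailingCoeff_nonzero_iff_nonzero.2 hD0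
  set j₀ : Fin d := ⟨0, hd⟩ with hj₀
  set β : Fin d → Option (Fin n) → F :=
    fun j o => (if j = j₀ then D.trailingCoeff⁻¹ else 1) * (N j o).coeff (Φ (L'' j)).natTrailingDegree
    with hβ
  refine ⟨fun _ => β, ?_⟩
  simp only [Finset.univ_unique, Finset.sum_singleton]
  have hsplit : ∀ j, (C (β j none) + ∑ k : Fin n, C (β j (some k)) * X k : MvPolynomial (Fin n) F) =
      C (if j = j₀ then D.trailingCoeff⁻¹ else 1) *
        (C ((N j none).coeff (Φ (L'' j)).natTrailingDegree) +
          ∑ k : Fin n, C ((N j (some k)).coeff (Φ (L'' j)).natTrailingDegree) * X k) := by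
    intro j
    simp only [hβ, map_mul, mul_add, Finset.mul_sum, mul_assoc]
  simp only [hsplit, Finset.prod_mul_distrib, ← map_prod C, Finset.prod_ite_eq', Finset.mem_univ,
    if_true, ← htc, ← mul_assoc, ← C_mul, inv_mul_cancel₀ htcD, C_1, one_mul]

end DDS2021

open DDS2021

/-- **DDS 2021/22, `\overline{ΠΣ} = ΠΣ` over EVERY field** (the typed fact
`DDS2021_lemma_2_21_piSigma` carries the paper's standing `[CharZero F]`; it is discharged as typed by
`DDS2021_lemma_2_21_piSigma_holds`, `DDS21PiSigmaClosedProofs.lean`, val-lit x2; this is the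
characteristic-free strengthening, by a different — trailing-coefficient — argument): a polynomial in
the approximative closure of the one-product class `spsClass (F(ε)) n 1 d` lies in `spsClass F n 1 d`.
[cite: DuttaDwivediSaxena2022, §1.1 Remark 1 and §3 proof of Thm. 3.2 (full version p0006 L140–141, p0026 L716)] -/
theorem DDS2021_lemma_2_21_piSigma_allFields (F : Type) [Field F] (n d : ℕ)
    (f : MvPolynomial (Fin n) F) (hf : f ∈ border (spsClass (RatFunc F) n 1 d)) :
    f ∈ spsClass F n 1 d := by
  obtain ⟨g, hg, hfg⟩ := hf
  exact isSPS_one_of_isEpsApprox hg hfg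

end Literature.Computability.AlgebraicComplexity

end
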